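/-
Copyright: lit-balaban Phase-2 proof seat p34 (gen 22).  Statement-level skeleton of a published paper; no proof claims beyond what the
kernel checks below.
-/
import Literature.MathematicalPhysics.QuantumFieldTheory.BalabanImbrieJaffe1984to88.BIJ88LocDerivHolder231RegionOfInputs
import Literature.MathematicalPhysics.QuantumFieldTheory.BalabanImbrieJaffe1984to88.BIJ88Loc231SmoothNearRegion
import Literature.MathematicalPhysics.QuantumFieldTheory.BalabanImbrieJaffe1984to88.BIJ88NeumannPropagatorSmoothNearCloseHolder

/-!
# [BalabanImbrieJaffe1988] p. 263 (2.31) and the sentence after (2.33), UNDER THE PRINTED LOCAL HYPOTHESIS (2.32): **THE HÖLDER MEMBER OF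
# ORDER `1 + θ` OF (2.31) FOR A GENERAL REGION `Ω ⊇ Ω₀` THAT IS A UNION OF `k`-BLOCKS, HYPOTHESIS-FREE AT A `U(1)` FIELD PLAQUETTE-SMALL NEAR
# `Ω` ONLY** (file C-V of p34's local-hypothesis series; the H1θ INSTANCE of r18's `C2S14-CLOSURE.md` §6 row «u smooth NEAR Ω only — the
# printed (2.32)» — p27 gen 38's `BIJ88LocDerivHolder231SmallPlaquetteRegion` §1–§3 with the GLOBAL plaquette hypothesis replaced by the LOCAL one)

T. Bałaban, J. Imbrie, A. Jaffe, *Effective action and cluster properties of the abelian Higgs model*, Commun. Math. Phys. **114** (1988)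
257–315 [BalabanImbrieJaffe1988], Sect. 2 p. 263 [PDF 7]: *"|(G_{k,loc}(u)f − G_k(Ω,u)f)(x)| ≦ e^{−cr(e_k)}e^{−c dist(suppt f,x)}‖f‖_∞, (2.31)
for dist(x, Ω^c) ≧ O(r(e_k)). … We assume that u is smooth in the □_α's entering the sum in (2.27); for (2.31) we assume smoothness throughout
the subset Ω ⊂ T_η. This means that in a neighborhood of each □_α there exists an A, λ such that u = exp[ie_kη(A + ∂λ)] with |∂A|, |∂*A| ≦
O(p(e_k)). (2.32) … Bounds analogous to (2.30), (2.31) hold for covariant derivatives and Holder derivatives of G_{k,loc}(u) of order less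
than two."* (text layer `p0007.txt` L16–26 re-read this session; the next printed sentence is *"We use G_{k,loc} to define a localized quadratic
form for scalar fields"*); [I] = T. Bałaban, J. Imbrie, A. Jaffe, *Renormalization of the Higgs model: minimizers, propagators and the stability
of mean field theory*, Commun. Math. Phys. **97** (1985) 299–329
[BalabanImbrieJaffe1985], §7.3 p. 326 [PDF 28]: *"The propagators arising from Δ_k(u_k), under the restriction (7.3.1) on the gauge field, also
satisfy the regularity and decay estimates of [7]. In order to remain within the framework of this reference, we remark that by change of
gauge u_k can be transformed in a local region Λ into a configuration of the form exp[ie_kηA], where A is smooth and small."*; [6] = [7] of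
[I] = T. Bałaban, *Regularity and decay of lattice Green's functions*, Commun. Math. Phys. **89** (1983) 571–597 [Balaban1983RegularityDecay],
Theorem p. 573 [PDF 3], (1.9)–(1.12).

statement-level skeleton of published theorems with citation tags; proofs where landed; nothing here is a claim about the Yang–Mills mass gap

PDFs held: `paper:balaban1988-cmp114-bij-abelian-higgs-effective-action` (p. 263 = PDF 7, text layer `p0007.txt` L16–26); `paper:balaban1985-cmp97-bij-higgs-minimizers`
(p. 326 = PDF 28, `p0028.txt` L18–23); `paper:balaban1983-cmp89-regularity-decay` (p. 573 = PDF 3, `p0003.txt` L12–24) — the three passages above RE-READ this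
session on the materialised pages (same wording; "Holder" sic on the text layer; the (1.12) display blank as recorded).

CITATION HEADER (lean-in-tree rule).  Part of the lit-balaban TYPED SKELETON (HOME `run/shared/lean/pub/lit-balaban/`), PHASE-2 proof seat
p34 gen 22 (unit `lit-balaban-p34-g22`; TAKING line HOME/STATUS.md 2026-08-23T15:37:53Z + ADDENDUM 15:51:18Z, free-target protocol G.5-34(d);
the item is p29 gen 34's HANDOFF (3) *«once [the (H5)] exists the instance is p27's FILE-3b one-liner»* and r18's `C2S14-CLOSURE.md` §6
*«the deriv231/holder231 INSTANCES under (2.32) remain OPEN … S each, no head weight»*).  WHAT IS REPRODUCED: the located H1θ MEMBER of rows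
**C2.Eq2.31** / **C2.Claim@263** under the definition row **C2.Eq2.32** (owner r18; cells only, heads unchanged) and the located consequence of
r15's **C1.Claim@326** (*"by change of gauge … in a local region Λ"*): the six [6]-inputs of p27's hypothesis-form theorem
`BIJ88LocDerivHolder231RegionOfInputs.derivHolder231_region_of_inputs_of_smooth` DISCHARGED BY NAME for every `k`-block union `Ω` under plaquette
smallness ON THE PLAQUETTES BASED WITHIN `2L^k` OF `Ω` ONLY (`‖u(∂p) − 1‖ ≤ θ_p` there, `0 ≤ θ_p`, `(L^{2k}θ_p)² ≤ 1/500`; nothing assumed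
elsewhere — a vortex in a hole of `Ω` is allowed): (H1)–(H4) by p29 g34's `BIJ88Loc231SmoothNearRegion.inputs_smoothNear_region` (p366816; p34
C-III's `close112_smoothNear_region[_deriv]` / `inputs110_smoothNear_region` underneath), (H5) by p34 C-IV's
`BIJ88NeumannPropagatorSmoothNearCloseHolder.closeHolder112_smoothNear_region`, (H6) by p34 B-II's
`BIJ88NeumannPropagatorSmoothNearRegionHolder.holder19_smoothNear_region_H6_of500` (p363273; the oriented-`plaqC` form of the local hypothesis it
takes is read off the `plaqHol` form by `plaqC_eq_toC_plaqHol` / `plaqC_swap` / `plaqC_self`, as in `BIJ85AbelianStokes.norm_plaqC_sub_one_le_of_plaqHol`).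
It is p27's `BIJ88LocDerivHolder231SmallPlaquetteRegion` (p362490) §1–§3 VERBATIM with the binder prefix of p29's local files
(`u`, `Ω`, `0 ≤ θ_p`, `∀ p, (∃ y ∈ Ω, |y − p.src|_∞ ≤ 2L^k) → ‖u(∂p) − 1‖ ≤ θ_p`, `((L^k)²θ_p)² ≤ 1/500`, `IsBlockUnion k Ω`) and the three
local providers substituted; §4 adds the forms under r18's typed (2.32) `SmoothOn` (p34 B-I's `plaqSmall_near_of_smoothOn`).  p27's §4 (the
actual background `u_k` of [I] (4.5.4)) is not repeated: `u_k` is plaquette-small on the whole torus (p34 gen 19's `smallPlaquette_actualBg`) and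
is served by p27's global file.  USED BY NAME, nothing restated: p27's `derivHolder231_region_of_inputs_of_smooth` (FILE 1b p361019),
`isBlockUnion_cubeT`; p29's `inputs_smoothNear_region`; p34's `closeHolder112_smoothNear_region`, `holder19_smoothNear_region_H6_of500`,
`plaqSmall_near_of_smoothOn`; r18's `zetaPi` facts (`BIJ88LocDeriv230ZetaPiFlatTorus`), `SmoothOn`;
`Literature.Analysis.Calculus.exists_abs_deriv_and_deriv_deriv_smoothTransition_le`; `BIJ85AbelianStokes.plaqC_eq_toC_plaqHol` / `plaqC_swap` /
`plaqC_self` / `norm_plaqC`, p33's `BIJ85HolonomyDeviation.norm_inv_sub_one`.  p27's three PRIVATE kernels (`exp_le_exp_of_rate`, `bound_mono`,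
`bound_mono₂`) are COPIED with attribution.  Kind: theorems only (no definition, no `Prop`-valued fact).

WHAT IS PROVED (theorems only; 0 `sorry`; standard axioms).
* §1 **`inputs6_smoothNear_region`** — for `1 ≤ d`, `d + 1 ≤ 3`, `ℓ ≥ 1`, `ℓ + 1` odd, `a > 0`, `0 ≤ θ < 1`: `∃ δ₀ c₀ > 0` such that on every
  torus (`P.d = d+1`, `P.L = ℓ+1`), at every `1 ≤ k ≤ K` with `2(L^k−1) + 4 < |T^{(0)}|`, for every `U(1)` field `u` and every union `Ω` of
  `k`-blocks with `‖u(∂p) − 1‖ ≤ θ_p` FOR THE PLAQUETTES BASED WITHIN `2L^k` OF `Ω`, `0 ≤ θ_p`, `(L^{2k}θ_p)² ≤ 1/500`, the six hypotheses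
  (H1)–(H6) of `derivHolder231_region_of_inputs_of_smooth` hold for `Ω` with `ρ := 17L^k`, at `(c₀, δ₀)` (p27's packaging verbatim).
* §2 **`derivHolder231_smoothNear_region_of_smooth`** — `∃ δ₀ C > 0` (on `d, ℓ, a, θ, K₁, K₂`): for the same tori, levels, fields and regions
  `Ω`, the reference box `Ω₀ = c·L^k + Π_i[0, L^kM₀_i) ⊆ Ω` shorter than the torus with torus gap `≥ R`, `s ≥ 1`, `R ≥ 18L^k + 3`,
  `0 ≤ R₁ < R₀`, `W ≥ 2s/3 + R₀/2 + R`, every real smooth cut-off `ζ″` (`|ζ″| ≤ 1`, `= 0` beyond `R₀`, `= 1` within `R₁`, `Δζ″ ≤ K₁/(R₀−R₁)`,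
  `Δ²ζ″ ≤ K₂/(R₀−R₁)²`), every `μ`, all `x₁, x₂` with the four bond ends in `Ω₀` at chart depth `≥ R₀ + R`, every `f` (`‖f‖_∞ ≤ F`, support
  at sup-torus distance `≥ D ≥ 0` from `x₁`, `x₂`), with `ψ = G_{k,loc}(u)f − G_k(Ω,u)f`:
  `(L^k/|x₁ − x₂|_T)^θ·‖U(Γ_{x₁,x₂})(D_uψ)(x₂,μ) − (D_uψ)(x₁,μ)‖ ≤ (L^kε)·C·(1 + L^k((R₀−R₁)⁻¹ + s⁻¹))²·[m·e^{−δ₀(2R−1)/L^k} + e^{−(δ₀/2)(R₁−1)/L^k}]·e^{−(δ₀/2)D/L^k}·F`,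
  `m = (⌊(L^k − 1 + R₀)/s⌋ + 3)^{d+1}`, `U(Γ)` = p30's `stairHol u x₁ x₂` — p27's §2 statement VERBATIM under the local hypothesis.
* §3 **`derivHolder231_smoothNear_region_zetaPi`** — §2 at r18's `zetaPi R₁ R₀ 0` (`1 ≤ R₁ < R₀ ≤ (|T^{(0)}| − 3)/2`), hypothesis-free in
  the cut-off.
* §4 **`derivHolder231_smoothOn_region_of_smooth`** / **`derivHolder231_smoothOn_region_zetaPi`** — §2 / §3 UNDER THE PRINTED (2.32): r18's
  `SmoothOn e_k η C 𝓅 X Bd Pl (cfg u)` with `Pl ⊇` the plaquettes based within `2L^k` of `Ω`, `Bd ⊇` their four bonds, threshold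
  `(L^{2k}·e_kη²C𝓅)² ≤ 1/500` (`0 ≤ e_k`, `0 ≤ C𝓅`).
With this and p29's `BIJ88Loc231SmoothNearRegion` (order 1 and order `θ′ ≤ 1`) EVERY member of the p. 263 sentence *"of order less than two"*
for (2.31) is in the tree hypothesis-free UNDER ITS PRINTED LOCAL HYPOTHESIS (2.32) for every `k`-block region `Ω ⊇ Ω₀` — the last OPEN cell
(H1θ) of r18's «printed (2.32)» row.
HONEST SCOPE / DIVERGENCE.  (i) Hypothesis LOCAL as printed, in the tree's currency (plaquette smallness on the plaquettes BASED within
sup-distance `2L^k` of `Ω`); (2.32) via `SmoothOn` with the clause `|∂*A|` and the site set `X` unused; nothing is asserted about the size of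
`C𝓅(e_k)` beyond the displayed inequalities (the local hypothesis is strictly weaker than p27's global one: p34 gen 21's
`BIJ88DeltaLocSmoothNearRegionCwt.opClose231_smoothNear_region_cwt_nonvacuous_local` exhibits a `U(1)` field flat near `Ω = [0,66)²` with a far
plaquette variable `−1`); the passage from the printed (7.3.1) on the unit-lattice field `v` to fine-plaquette smallness is
not claimed here (p33's lane; referee ref-5 D-g64-1).  (ii)–(iv) of p27's file otherwise verbatim: `Ω` a union of `k`-blocks containing the
reference box `Ω₀` (p31's `IsBlockUnion`); DEEP BONDS ONLY (chart depth `≥ R₀ + R` in `Ω₀`, `R ≥ 18L^k + 3`; (H5)'s pairs `17L^k`-deep, (H6)'s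
`3L^k`-deep weakened to `17L^k`); `d + 1 ∈ {2,3}`, `L` odd `≥ 2`; transport `stairHol`; smooth cut-offs only; constants existential (`δ₀ = min`,
`c₀ = max` of the providers'), not optimized; `set_option maxHeartbeats 800000` on §1–§3 (long statements, p27's setting).  DIVERGENCE OF METHOD
as in every file of this lane (perturbative small-field estimates in place of [6]'s random walk).  Imports: p27's FILE 1b, p29's
`BIJ88Loc231SmoothNearRegion`, p34's C-IV.  Literature + Mathlib only.  Nothing here is summit progress, continuum or Clay.  Unit
`lit-balaban-p34` (literature-prover-lit-balaban-p34-g22-0), HOME `run/shared/lean/pub/lit-balaban/`, 2026-08-23.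
-/

open scoped BigOperators Matrix ComplexConjugate
open Finset Matrix

namespace Literature.MathematicalPhysics.QuantumFieldTheory.BalabanImbrieJaffe1984to88.BIJ88LocDerivHolder231SmoothNearRegion

open Literature.MathematicalPhysics.QuantumFieldTheory.Balaban1983to89
open BIJ88Sect3Statements (U1 toC cfg covD)
open BIJ85BlockAveragesTorus BIJ85BlockAveragesTorusK
open BIJ88NeumannPropagator227Torus (gBox)
open BIJ88DeltaLoc234Torus (gLocT)
open BIJ88NeumannPropagatorFlatDecayCube (cubeT boxCoord isBlockUnion_cubeT)
open BIJ88LocWeights227Torus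
open BIJ85AbelianStokes (plaqC plaqC_self plaqC_swap plaqC_eq_toC_plaqHol norm_plaqC)
open BIJ88NeumannNoZeroModesTorus (IsBlockUnion)
open BIJ88Loc231SmoothNearRegion (inputs_smoothNear_region)
open BIJ88NeumannPropagatorSmoothNearCloseHolder (closeHolder112_smoothNear_region)
open BIJ85ScalarPropagatorHolderDecay (stairHol)
open BIJ88NeumannPropagatorSmoothNearRegionHolder (holder19_smoothNear_region_H6_of500)
open BIJ88NeumannPropagatorSmoothNearRegion (plaqSmall_near_of_smoothOn)
open BIJ88Sect2Statements (SmoothOn)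
open GaugeField (plaqHol)
open LatticeFieldCalculus (supDist)
open BIJ85HolonomyDeviation (norm_inv_sub_one)
open BIJ88LocDerivHolder231RegionOfInputs (derivHolder231_region_of_inputs_of_smooth)

noncomputable section

variable {d : ℕ} {P : Params}

/-- kernel (p27's private `exp_le_exp_of_rate`, copied): `e^{−δ'E} ≤ e^{−δE}` for `δ ≤ δ'`, `E ≥ 0`. [cite: Balaban1983RegularityDecay, Theorem p.573 (1.12)] -/
private theorem exp_le_exp_of_rate {δ δ' E : ℝ} (hδ : δ ≤ δ') (hE : 0 ≤ E) : Real.exp (-(δ' * E)) ≤ Real.exp (-(δ * E)) :=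
  Real.exp_le_exp.2 (neg_le_neg (mul_le_mul_of_nonneg_right hδ hE))

/-- kernel (p27's private `bound_mono`, copied): monotonicity of a bound `c·e^{−δE}·F` in the constant and the rate. [cite: Balaban1983RegularityDecay, Theorem p.573 (1.10)] -/
private theorem bound_mono {c C δ Δ E F : ℝ} (hc : 0 ≤ c) (hcC : c ≤ C) (hΔ : Δ ≤ δ) (hE : 0 ≤ E) (hF : 0 ≤ F) :
    c * Real.exp (-(δ * E)) * F ≤ C * Real.exp (-(Δ * E)) * F :=
  mul_le_mul_of_nonneg_right (mul_le_mul hcC (exp_le_exp_of_rate hΔ hE) (Real.exp_pos _).le (hc.trans hcC)) hF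

/-- kernel (p27's private `bound_mono₂`, copied): the same with the (1.12) bracket. [cite: Balaban1983RegularityDecay, Theorem p.573 (1.12)] -/
private theorem bound_mono₂ {c C δ Δ E E' F : ℝ} (hc : 0 ≤ c) (hcC : c ≤ C) (hΔ : Δ ≤ δ) (hE : 0 ≤ E) (hE' : 0 ≤ E') (hF : 0 ≤ F) :
    c * Real.exp (-(δ * E)) * Real.exp (-(δ * E')) * F ≤ C * Real.exp (-(Δ * E)) * Real.exp (-(Δ * E')) * F :=
  mul_le_mul_of_nonneg_right (mul_le_mul (mul_le_mul hcC (exp_le_exp_of_rate hΔ hE) (Real.exp_pos _).le (hc.trans hcC))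
    (exp_le_exp_of_rate hΔ hE') (Real.exp_pos _).le (mul_nonneg (hc.trans hcC) (Real.exp_pos _).le)) hF

/-! ## §1 The six [6]-inputs for a union `Ω` of `k`-blocks at a field plaquette-small NEAR `Ω` only, at one pair of constants -/

set_option maxHeartbeats 800000 in
/-- **THE SIX [6]-INPUTS OF `derivHolder231_region_of_inputs_of_smooth` FOR A UNION `Ω` OF `k`-BLOCKS AT A FIELD PLAQUETTE-SMALL NEAR `Ω` ONLY
(THE PRINTED (2.32)), AT ONE PAIR OF CONSTANTS, DEPTH `ρ = 17L^k`** ([BalabanImbrieJaffe1985] p. 326 (7.3.1) and *"The propagators arising from Δ_k(u_k), under the restriction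
(7.3.1) on the gauge field, also satisfy the regularity and decay estimates of [7]"*; [6] = [Balaban1983RegularityDecay] Theorem p. 573
(1.9)–(1.12)): for `1 ≤ d`, `d + 1 ≤ 3`, `ℓ ≥ 1`, `ℓ + 1` odd, `a > 0`, `0 ≤ θ < 1` THERE ARE `δ₀, c₀ > 0` (on `d, ℓ, a, θ`) such that on every
torus (`P.d = d+1`, `P.L = ℓ+1`), at every `1 ≤ k ≤ K` with `2(L^k−1) + 4 < |T^{(0)}|`, for every field with `|u(∂p) − 1| ≤ θ_p`, `0 ≤ θ_p`,
`(L^{2k}θ_p)² ≤ 1/500` — HERE WITH `|u(∂p) − 1| ≤ θ_p` ASKED ONLY FOR THE PLAQUETTES BASED WITHIN `2L^k` OF `Ω` ([BalabanImbrieJaffe1988] (2.32)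
*"for (2.31) we assume smoothness throughout the subset Ω"*) —, every `k`-block union `Ω`: (H1)–(H4) = p29 g34's `inputs_smoothNear_region`
(p366816; depth `L^k` weakened to `17L^k`), (H5) = p34 C-IV's `closeHolder112_smoothNear_region` for the fitting cubes `□ ⊆ Ω`, (H6) = p34 B-II's
`holder19_smoothNear_region_H6_of500` (p363273; depth `3L^k` weakened to `17L^k`; its oriented-`plaqC` local hypothesis read off the `plaqHol`
one) — all six at `(c₀, δ₀)`, in the binder shapes of p27's `derivHolder231_region_of_inputs_of_smooth` at the region `Ω`, `ρ := 17L^k`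
(p27's `inputs6_smallPlaquette_region` VERBATIM otherwise).
[cite: BalabanImbrieJaffe1985, (7.3.1) p.326] [cite: Balaban1983RegularityDecay, Theorem p.573 (1.9)–(1.12)]
[cite: BalabanImbrieJaffe1988, (2.31)–(2.32) p.263] -/
theorem inputs6_smoothNear_region (d ℓ : ℕ) (hd1 : 1 ≤ d) (hd3 : d + 1 ≤ 3) (hℓ : 1 ≤ ℓ) (hodd : Odd (ℓ + 1)) {a : ℝ} (ha : 0 < a)
    {θ : ℝ} (hθ0 : 0 ≤ θ) (hθ1 : θ < 1) :
    ∃ δ₀ c₀ : ℝ, 0 < δ₀ ∧ 0 < c₀ ∧ ∀ (P : Params) (hPd : P.d = d + 1), P.L = ℓ + 1 →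
      ∀ (k : ℕ), 1 ≤ k → k ≤ P.K → 2 * (P.L ^ k - 1) + 4 < P.sitesPerDir 0 →
      ∀ (U : GaugeField P 0 U1) (Ω : Finset (Balaban1983to89.Site P 0)) (θp : ℝ), 0 ≤ θp →
        (∀ p : Balaban1983to89.Plaq P 0, (∃ y ∈ Ω, supDist y p.src ≤ 2 * P.L ^ k) → ‖toC (plaqHol U p) - 1‖ ≤ θp) →
        (((P.L : ℝ) ^ k) ^ 2 * θp) ^ 2 ≤ 1 / 500 → IsBlockUnion k Ω →
      -- (H1) the (1.11)–(1.12) covariant-derivative closeness member for the fitting no-wrap cubes `□ ⊆ Ω`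
      (∀ (c' M' : Fin (d + 1) → ℕ), (∀ i, 1 ≤ M' i) → (∀ i, c' i * P.L ^ k + P.L ^ k * M' i ≤ P.sitesPerDir 0) →
          (∀ i, P.L ^ k * M' i < P.sitesPerDir 0) → (cubeT hPd (P.L ^ k) c' fun i => P.L ^ k * M' i) ⊆ Ω →
        ∀ (x : Balaban1983to89.Site P 0) (μ : Fin P.d), x ∈ (cubeT hPd (P.L ^ k) c' fun i => P.L ^ k * M' i) →
          x.shift μ ∈ (cubeT hPd (P.L ^ k) c' fun i => P.L ^ k * M' i) →
          (∀ w, w ∉ (cubeT hPd (P.L ^ k) c' fun i => P.L ^ k * M' i) → 17 * (P.L : ℝ) ^ k ≤ B5Ineq137Torus.T P 0 x w) →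
        ∀ (g : Balaban1983to89.Site P 0 → ℂ) (F D Db Df : ℝ), (∀ y, ‖g y‖ ≤ F) →
          (∀ y, y ∉ (cubeT hPd (P.L ^ k) c' fun i => P.L ^ k * M' i) → g y = 0) →
          0 ≤ D → (∀ y, g y ≠ 0 → D ≤ B5Ineq137Torus.T P 0 x y) →
          0 ≤ Db → (∀ w, w ∉ (cubeT hPd (P.L ^ k) c' fun i => P.L ^ k * M' i) → Db ≤ B5Ineq137Torus.T P 0 x w) →
          0 ≤ Df → (∀ y, g y ≠ 0 → ∀ w, w ∉ (cubeT hPd (P.L ^ k) c' fun i => P.L ^ k * M' i) → Df ≤ B5Ineq137Torus.T P 0 y w) →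
          ‖covD P.eps⁻¹ (cfg U) (gBox (B1RG242Torus.α P a k * (P.L : ℝ) ^ (k * P.d)) P.eps⁻¹ U k
                  (cubeT hPd (P.L ^ k) c' fun i => P.L ^ k * M' i) *ᵥ g) ⟨x, μ⟩ -
              covD P.eps⁻¹ (cfg U) (gBox (B1RG242Torus.α P a k * (P.L : ℝ) ^ (k * P.d)) P.eps⁻¹ U k Ω *ᵥ g) ⟨x, μ⟩‖ ≤
            P.spacing k * (c₀ * Real.exp (-(δ₀ * (((P.L : ℝ) ^ k)⁻¹ * D))) * Real.exp (-(δ₀ * (((P.L : ℝ) ^ k)⁻¹ * (Db + Df)))) * F)) ∧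
      -- (H2) the (1.11)–(1.12) value closeness member for the same cubes and rows
      (∀ (c' M' : Fin (d + 1) → ℕ), (∀ i, 1 ≤ M' i) → (∀ i, c' i * P.L ^ k + P.L ^ k * M' i ≤ P.sitesPerDir 0) →
          (∀ i, P.L ^ k * M' i < P.sitesPerDir 0) → (cubeT hPd (P.L ^ k) c' fun i => P.L ^ k * M' i) ⊆ Ω →
        ∀ (x : Balaban1983to89.Site P 0), x ∈ (cubeT hPd (P.L ^ k) c' fun i => P.L ^ k * M' i) →
          (∀ w, w ∉ (cubeT hPd (P.L ^ k) c' fun i => P.L ^ k * M' i) → 17 * (P.L : ℝ) ^ k ≤ B5Ineq137Torus.T P 0 x w) →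
        ∀ (g : Balaban1983to89.Site P 0 → ℂ) (F D Db Df : ℝ), (∀ y, ‖g y‖ ≤ F) →
          (∀ y, y ∉ (cubeT hPd (P.L ^ k) c' fun i => P.L ^ k * M' i) → g y = 0) →
          0 ≤ D → (∀ y, g y ≠ 0 → D ≤ B5Ineq137Torus.T P 0 x y) →
          0 ≤ Db → (∀ w, w ∉ (cubeT hPd (P.L ^ k) c' fun i => P.L ^ k * M' i) → Db ≤ B5Ineq137Torus.T P 0 x w) →
          0 ≤ Df → (∀ y, g y ≠ 0 → ∀ w, w ∉ (cubeT hPd (P.L ^ k) c' fun i => P.L ^ k * M' i) → Df ≤ B5Ineq137Torus.T P 0 y w) →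
          ‖(gBox (B1RG242Torus.α P a k * (P.L : ℝ) ^ (k * P.d)) P.eps⁻¹ U k (cubeT hPd (P.L ^ k) c' fun i => P.L ^ k * M' i) *ᵥ g) x -
              (gBox (B1RG242Torus.α P a k * (P.L : ℝ) ^ (k * P.d)) P.eps⁻¹ U k Ω *ᵥ g) x‖ ≤
            P.spacing k ^ 2 * (c₀ * Real.exp (-(δ₀ * (((P.L : ℝ) ^ k)⁻¹ * D))) * Real.exp (-(δ₀ * (((P.L : ℝ) ^ k)⁻¹ * (Db + Df)))) * F)) ∧
      -- (H3) the (1.10) covariant-derivative member of `G_k(Ω,u)` at the `17L^k`-deep rows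
      (∀ (x : Balaban1983to89.Site P 0), x ∈ Ω → (∀ w, w ∉ Ω → 17 * (P.L : ℝ) ^ k ≤ B5Ineq137Torus.T P 0 x w) →
        ∀ (μ : Fin P.d) (g : Balaban1983to89.Site P 0 → ℂ) (F D : ℝ), (∀ y, ‖g y‖ ≤ F) → 0 ≤ D →
          (∀ y, g y ≠ 0 → D ≤ B5Ineq137Torus.T P 0 x y) →
          ‖covD P.eps⁻¹ (cfg U) (gBox (B1RG242Torus.α P a k * (P.L : ℝ) ^ (k * P.d)) P.eps⁻¹ U k Ω *ᵥ g) ⟨x, μ⟩‖ ≤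
            P.spacing k * (c₀ * Real.exp (-(δ₀ * (((P.L : ℝ) ^ k)⁻¹ * D))) * F)) ∧
      -- (H4) the (1.10) value member of `G_k(Ω,u)` at the `17L^k`-deep rows
      (∀ (x : Balaban1983to89.Site P 0), x ∈ Ω → (∀ w, w ∉ Ω → 17 * (P.L : ℝ) ^ k ≤ B5Ineq137Torus.T P 0 x w) →
        ∀ (g : Balaban1983to89.Site P 0 → ℂ) (F D : ℝ), (∀ y, ‖g y‖ ≤ F) → 0 ≤ D →
          (∀ y, g y ≠ 0 → D ≤ B5Ineq137Torus.T P 0 x y) →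
          ‖(gBox (B1RG242Torus.α P a k * (P.L : ℝ) ^ (k * P.d)) P.eps⁻¹ U k Ω *ᵥ g) x‖ ≤
            P.spacing k ^ 2 * (c₀ * Real.exp (-(δ₀ * (((P.L : ℝ) ^ k)⁻¹ * D))) * F)) ∧
      -- (H5) the (1.11)–(1.12) Hölder-of-`D_u` closeness member for the fitting no-wrap cubes `□ ⊆ Ω` at pairs of distinct `17L^k`-deep rows
      (∀ (c' M' : Fin (d + 1) → ℕ), (∀ i, 1 ≤ M' i) → (∀ i, c' i * P.L ^ k + P.L ^ k * M' i ≤ P.sitesPerDir 0) →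
          (∀ i, P.L ^ k * M' i < P.sitesPerDir 0) → (cubeT hPd (P.L ^ k) c' fun i => P.L ^ k * M' i) ⊆ Ω →
        ∀ (x₁ x₂ : Balaban1983to89.Site P 0) (μ : Fin P.d), x₁ ≠ x₂ → x₁ ∈ (cubeT hPd (P.L ^ k) c' fun i => P.L ^ k * M' i) → x₂ ∈ (cubeT hPd (P.L ^ k) c' fun i => P.L ^ k * M' i) →
          (∀ w, w ∉ (cubeT hPd (P.L ^ k) c' fun i => P.L ^ k * M' i) → 17 * (P.L : ℝ) ^ k ≤ B5Ineq137Torus.T P 0 x₁ w) →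
          (∀ w, w ∉ (cubeT hPd (P.L ^ k) c' fun i => P.L ^ k * M' i) → 17 * (P.L : ℝ) ^ k ≤ B5Ineq137Torus.T P 0 x₂ w) →
        ∀ (g : Balaban1983to89.Site P 0 → ℂ) (F D Db Df : ℝ), (∀ y, ‖g y‖ ≤ F) →
          (∀ y, y ∉ (cubeT hPd (P.L ^ k) c' fun i => P.L ^ k * M' i) → g y = 0) →
          0 ≤ D → (∀ y, g y ≠ 0 → D ≤ B5Ineq137Torus.T P 0 x₁ y) → (∀ y, g y ≠ 0 → D ≤ B5Ineq137Torus.T P 0 x₂ y) →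
          0 ≤ Db → (∀ w, w ∉ (cubeT hPd (P.L ^ k) c' fun i => P.L ^ k * M' i) → Db ≤ B5Ineq137Torus.T P 0 x₁ w) →
          (∀ w, w ∉ (cubeT hPd (P.L ^ k) c' fun i => P.L ^ k * M' i) → Db ≤ B5Ineq137Torus.T P 0 x₂ w) →
          0 ≤ Df → (∀ y, g y ≠ 0 → ∀ w, w ∉ (cubeT hPd (P.L ^ k) c' fun i => P.L ^ k * M' i) → Df ≤ B5Ineq137Torus.T P 0 y w) →
          ((P.L : ℝ) ^ k / B5Ineq137Torus.T P 0 x₁ x₂) ^ θ *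
              ‖stairHol U x₁ x₂ *
                  covD P.eps⁻¹ (cfg U) (gBox (B1RG242Torus.α P a k * (P.L : ℝ) ^ (k * P.d)) P.eps⁻¹ U k (cubeT hPd (P.L ^ k) c' fun i => P.L ^ k * M' i) *ᵥ g -
                    gBox (B1RG242Torus.α P a k * (P.L : ℝ) ^ (k * P.d)) P.eps⁻¹ U k Ω *ᵥ g) ⟨x₂, μ⟩ -
                covD P.eps⁻¹ (cfg U) (gBox (B1RG242Torus.α P a k * (P.L : ℝ) ^ (k * P.d)) P.eps⁻¹ U k (cubeT hPd (P.L ^ k) c' fun i => P.L ^ k * M' i) *ᵥ g -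
                    gBox (B1RG242Torus.α P a k * (P.L : ℝ) ^ (k * P.d)) P.eps⁻¹ U k Ω *ᵥ g) ⟨x₁, μ⟩‖ ≤
            P.spacing k * (c₀ * Real.exp (-(δ₀ * (((P.L : ℝ) ^ k)⁻¹ * D))) * Real.exp (-(δ₀ * (((P.L : ℝ) ^ k)⁻¹ * (Db + Df)))) * F)) ∧
      -- (H6) the (1.9) Hölder-of-`D_u` member of `G_k(Ω,u)` at pairs of distinct `17L^k`-deep rows
      (∀ (x₁ x₂ : Balaban1983to89.Site P 0) (μ : Fin P.d), x₁ ≠ x₂ → x₁ ∈ Ω → x₂ ∈ Ω →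
          (∀ w, w ∉ Ω → 17 * (P.L : ℝ) ^ k ≤ B5Ineq137Torus.T P 0 x₁ w) → (∀ w, w ∉ Ω → 17 * (P.L : ℝ) ^ k ≤ B5Ineq137Torus.T P 0 x₂ w) →
        ∀ (g : Balaban1983to89.Site P 0 → ℂ) (F D : ℝ), (∀ y, ‖g y‖ ≤ F) → 0 ≤ D →
          (∀ y, g y ≠ 0 → D ≤ B5Ineq137Torus.T P 0 x₁ y) → (∀ y, g y ≠ 0 → D ≤ B5Ineq137Torus.T P 0 x₂ y) →
          ((P.L : ℝ) ^ k / B5Ineq137Torus.T P 0 x₁ x₂) ^ θ *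
              ‖stairHol U x₁ x₂ * covD P.eps⁻¹ (cfg U) (gBox (B1RG242Torus.α P a k * (P.L : ℝ) ^ (k * P.d)) P.eps⁻¹ U k Ω *ᵥ g) ⟨x₂, μ⟩ -
                covD P.eps⁻¹ (cfg U) (gBox (B1RG242Torus.α P a k * (P.L : ℝ) ^ (k * P.d)) P.eps⁻¹ U k Ω *ᵥ g) ⟨x₁, μ⟩‖ ≤
            P.spacing k * (c₀ * Real.exp (-(δ₀ * (((P.L : ℝ) ^ k)⁻¹ * D))) * F)) := by
  obtain ⟨δa, ca, hδa, hca, HA⟩ := inputs_smoothNear_region d ℓ hd1 hd3 hℓ hodd ha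
  obtain ⟨c₃, δ₃, hc₃, hδ₃, H5p⟩ := closeHolder112_smoothNear_region d ℓ hd1 hd3 hℓ hodd ha hθ0 hθ1
  obtain ⟨t₀, cH, ht₀, hcH, H6p⟩ := holder19_smoothNear_region_H6_of500 d ℓ hd1 hd3 hℓ hodd ha hθ0 hθ1
  -- the common constants
  set δ₀ : ℝ := min δa (min δ₃ t₀) with hδ₀def
  set c₀ : ℝ := max ca (max c₃ cH) with hc₀def
  have hδ₀ : 0 < δ₀ := lt_min hδa (lt_min hδ₃ ht₀)
  have hc₀ : 0 < c₀ := lt_max_of_lt_left hca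
  have hca0 : ca ≤ c₀ := le_max_left _ _
  have hc30 : c₃ ≤ c₀ := (le_max_left _ _).trans (le_max_right _ _)
  have hcH0 : cH ≤ c₀ := (le_max_right _ _).trans (le_max_right _ _)
  have hδa0 : δ₀ ≤ δa := min_le_left _ _
  have hδ30 : δ₀ ≤ δ₃ := (min_le_right _ _).trans (min_le_left _ _)
  have hδH0 : δ₀ ≤ t₀ := (min_le_right _ _).trans (min_le_right _ _)
  refine ⟨δ₀, c₀, hδ₀, hc₀, ?_⟩
  intro P hPd hPL k hk1 hkK hbig U Ω θp hθp0 hplaq hsm hΩ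
  have hkm : k ≤ P.m + P.K := hkK.trans (Nat.le_add_left _ _)
  have hPk : (0 : ℝ) < (P.L : ℝ) ^ k := pow_pos P.cast_L_pos k
  have hPkinv : 0 ≤ ((P.L : ℝ) ^ k)⁻¹ := (inv_pos.2 hPk).le
  have hsk : 0 < P.spacing k := P.spacing_pos k
  have hsk2 : 0 ≤ P.spacing k ^ 2 := by positivity
  obtain ⟨H1p, H2p, H3p, H4p⟩ := HA P hPd hPL k hk1 hkK hbig U Ω θp hθp0 hplaq hsm hΩ
  -- the plaquette hypothesis near `Ω` in the oriented (`plaqC`) currency of the (H6) provider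
  have hplaqC : ∀ (y : Balaban1983to89.Site P 0) (μ ν : Fin P.d), (∃ w ∈ Ω, supDist w y ≤ 2 * P.L ^ k) → ‖plaqC U y μ ν - 1‖ ≤ θp := by
    intro y μ ν hy
    rcases lt_trichotomy μ ν with h | h | h
    · rw [plaqC_eq_toC_plaqHol U y h]; exact hplaq ⟨y, μ, ν, h⟩ hy
    · subst h; rw [plaqC_self, sub_self, norm_zero]; exact hθp0
    · rw [plaqC_swap, norm_inv_sub_one (norm_plaqC U y ν μ), plaqC_eq_toC_plaqHol U y h]; exact hplaq ⟨y, ν, μ, h⟩ hy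
  -- depth `17L^k` implies depth `L^k`
  have h17 : ∀ {x w : Balaban1983to89.Site P 0}, 17 * (P.L : ℝ) ^ k ≤ B5Ineq137Torus.T P 0 x w → (P.L : ℝ) ^ k ≤ B5Ineq137Torus.T P 0 x w :=
    fun h => le_trans (by linarith) h
  refine ⟨?_, ?_, ?_, ?_, ?_, ?_⟩
  · -- (H1)
    intro c' M' hM' hfit' hN' hsub x μ hx hxe hρx g F D Db Df hF hsuppg hD hsD hDb hsDb hDf hsDf
    have hF0 : 0 ≤ F := (norm_nonneg _).trans (hF x)
    exact (H1p c' M' hM' hfit' hN' hsub x μ hx hxe (fun w hw => h17 (hρx w hw)) g F D Db Df hF hsuppg hD hsD hDb hsDb hDf hsDf).trans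
      (mul_le_mul_of_nonneg_left
        (bound_mono₂ hca.le hca0 hδa0 (mul_nonneg hPkinv hD) (mul_nonneg hPkinv (add_nonneg hDb hDf)) hF0) hsk.le)
  · -- (H2)
    intro c' M' hM' hfit' hN' hsub x hx hρx g F D Db Df hF hsuppg hD hsD hDb hsDb hDf hsDf
    have hF0 : 0 ≤ F := (norm_nonneg _).trans (hF x)
    exact (H2p c' M' hM' hfit' hN' hsub x hx (fun w hw => h17 (hρx w hw)) g F D Db Df hF hsuppg hD hsD hDb hsDb hDf hsDf).trans
      (mul_le_mul_of_nonneg_left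
        (bound_mono₂ hca.le hca0 hδa0 (mul_nonneg hPkinv hD) (mul_nonneg hPkinv (add_nonneg hDb hDf)) hF0) hsk2)
  · -- (H3)
    intro x hx hρ μ g F D hF hD hsupp
    have hF0 : 0 ≤ F := (norm_nonneg _).trans (hF x)
    exact (H3p x hx (fun w hw => h17 (hρ w hw)) μ g F D hF hD hsupp).trans
      (mul_le_mul_of_nonneg_left (bound_mono hca.le hca0 hδa0 (mul_nonneg hPkinv hD) hF0) hsk.le)
  · -- (H4)
    intro x hx hρ g F D hF hD hsupp
    have hF0 : 0 ≤ F := (norm_nonneg _).trans (hF x)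
    exact (H4p x hx (fun w hw => h17 (hρ w hw)) g F D hF hD hsupp).trans
      (mul_le_mul_of_nonneg_left (bound_mono hca.le hca0 hδa0 (mul_nonneg hPkinv hD) hF0) hsk2)
  · -- (H5): this seat's region Hölder `δG` member with `□ = cubeT c' M' ⊆ Ω`
    intro c' M' hM' hfit' hN' hsub x₁ x₂ μ hne hx₁ hx₂ hρ₁ hρ₂ g F D Db Df hF hsuppg hD hsD₁ hsD₂ hDb hsDb₁ hsDb₂ hDf hsDf
    have hF0 : 0 ≤ F := (norm_nonneg _).trans (hF x₁)
    have hBU : IsBlockUnion k (cubeT hPd (P.L ^ k) c' fun i => P.L ^ k * M' i) := isBlockUnion_cubeT hPd hkm rfl hfit'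
    have key := H5p P hPd hPL k hk1 hkK hbig U Ω θp hθp0 hplaq hsm _ hBU hΩ hsub x₁ x₂ μ hne hx₁ hx₂ hρ₁ hρ₂ g F D Db Df
      hF hsuppg hD hsD₁ hsD₂ hDb hsDb₁ hsDb₂ hDf hsDf
    exact key.trans (mul_le_mul_of_nonneg_left
      (bound_mono₂ hc₃.le hc30 hδ30 (mul_nonneg hPkinv hD) (mul_nonneg hPkinv (add_nonneg hDb hDf)) hF0) hsk.le)
  · -- (H6): p34 g20's region Hölder member (1.9) at small plaquette fields (depth `3L^k` weakened to `17L^k`)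
    intro x₁ x₂ μ hne hx₁ hx₂ hρ₁ hρ₂ g F D hF hD hsD₁ hsD₂
    have hF0 : 0 ≤ F := (norm_nonneg _).trans (hF x₁)
    have h317 : 3 * (P.L : ℝ) ^ k ≤ 17 * (P.L : ℝ) ^ k := by linarith [hPk.le]
    have key := H6p P hPd hPL k hk1 hkK hbig Ω hΩ U θp hθp0 hplaqC hsm (17 * (P.L : ℝ) ^ k) h317 x₁ x₂ μ hne hx₁ hx₂ hρ₁ hρ₂ g F D hF hD
      hsD₁ hsD₂
    exact key.trans (mul_le_mul_of_nonneg_left (bound_mono hcH.le hcH0 hδH0 (mul_nonneg hPkinv hD) hF0) hsk.le)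

/-! ## §2 The Hölder member of order `1 + θ` of (2.31) for a `k`-block region `Ω ⊇ Ω₀`, hypothesis-free, plaquettes small NEAR `Ω` only -/

set_option maxHeartbeats 800000 in
/-- **THE HÖLDER MEMBER OF ORDER `1 + θ` (`0 ≤ θ < 1`) OF (2.31) FOR A `k`-BLOCK REGION `Ω ⊇ Ω₀`, HYPOTHESIS-FREE AT A `U(1)` FIELD
PLAQUETTE-SMALL NEAR `Ω` ONLY — THE PRINTED LOCAL HYPOTHESIS (2.32)** (p. 263: *"Bounds analogous to (2.30), (2.31) hold for covariant derivatives and Hölder derivatives of G_{k,loc}(u) of order less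
than two"*; [I] p. 326: *"The propagators arising from Δ_k(u_k), under the restriction (7.3.1) on the gauge field, also satisfy the regularity
and decay estimates of [7]"*; p. 263: *"for (2.31) we assume smoothness throughout the subset Ω ⊂ T_η … (2.32)"*): p27's hypothesis-form
`derivHolder231_region_of_inputs_of_smooth` at a union `Ω` of `k`-blocks containing `Ω₀`, `ρ = 17L^k`, its six inputs discharged by §1 UNDER
THE LOCAL HYPOTHESIS; the slack `e^{3δ₀}` absorbed in the constant (p27's `derivHolder231_smallPlaquette_region_of_smooth` VERBATIM otherwise).
For every torus of the series (`P.d = d+1 ∈ {2,3}`, `P.L = ℓ+1` odd), every `1 ≤ k ≤ K` with `2(L^k−1) + 4 < |T^{(0)}|`, every `U(1)` field and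
`k`-block union `Ω` with `|u(∂p) − 1| ≤ θ_p` for the plaquettes based within `2L^k` of `Ω`, `0 ≤ θ_p`, `(L^{2k}θ_p)² ≤ 1/500`, every
reference box `Ω₀ ⊆ Ω` (torus gap `≥ R`), `s ≥ 1`, `R ≥ 18L^k + 3`, `0 ≤ R₁ < R₀`, `W ≥ 2s/3 + R₀/2 + R`, every smooth cut-off `ζ″` (`K₁`, `K₂`),
every `μ`, all `x₁, x₂` with the four bond ends at chart depth `≥ R₀ + R`, every `f` supported at distance `≥ D ≥ 0` from `x₁`, `x₂`:
`(L^k/|x₁ − x₂|_T)^θ·‖stairHol u x₁ x₂·(D_uψ)(x₂,μ) − (D_uψ)(x₁,μ)‖ ≤ (L^kε)·C·(1 + L^k((R₀−R₁)⁻¹ + s⁻¹))²·[m·e^{−δ₀(2R−1)/L^k} +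
e^{−(δ₀/2)(R₁−1)/L^k}]·e^{−(δ₀/2)D/L^k}·F`, `ψ = G_{k,loc}(u)f − G_k(Ω,u)f`.
[cite: BalabanImbrieJaffe1988, (2.31)–(2.32) p.263] [cite: BalabanImbrieJaffe1985, (7.3.1) p.326]
[cite: Balaban1983RegularityDecay, Theorem p.573 (1.9), (1.11)–(1.12)] -/
theorem derivHolder231_smoothNear_region_of_smooth (d ℓ : ℕ) (hd1 : 1 ≤ d) (hd3 : d + 1 ≤ 3) (hℓ : 1 ≤ ℓ) (hodd : Odd (ℓ + 1))
    {a : ℝ} (ha : 0 < a) {θ : ℝ} (hθ0 : 0 ≤ θ) (hθ1 : θ < 1) {K₁ K₂ : ℝ} (hK₁ : 0 ≤ K₁) (hK₂ : 0 ≤ K₂) :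
    ∃ δ₀ C : ℝ, 0 < δ₀ ∧ 0 < C ∧ ∀ (P : Params) (hPd : P.d = d + 1), P.L = ℓ + 1 →
      ∀ (k : ℕ), 1 ≤ k → k ≤ P.K → 2 * (P.L ^ k - 1) + 4 < P.sitesPerDir 0 →
      ∀ (U : GaugeField P 0 U1) (Ω : Finset (Balaban1983to89.Site P 0)) (θp : ℝ), 0 ≤ θp →
        (∀ p : Balaban1983to89.Plaq P 0, (∃ y ∈ Ω, supDist y p.src ≤ 2 * P.L ^ k) → ‖toC (plaqHol U p) - 1‖ ≤ θp) →
        (((P.L : ℝ) ^ k) ^ 2 * θp) ^ 2 ≤ 1 / 500 → IsBlockUnion k Ω →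
      ∀ (c M0 : Fin (d + 1) → ℕ), (∀ i, 1 ≤ M0 i) →
        (∀ i, c i * P.L ^ k + P.L ^ k * M0 i ≤ P.sitesPerDir 0) → (∀ i, P.L ^ k * M0 i < P.sitesPerDir 0) →
        (cubeT hPd (P.L ^ k) c fun i => P.L ^ k * M0 i) ⊆ Ω →
      ∀ (s W : ℕ), 1 ≤ s → ∀ (R R₀ R₁ : ℝ), 18 * (P.L : ℝ) ^ k + 3 ≤ R → 0 ≤ R₁ → R₁ < R₀ → 2 * (s : ℝ) / 3 + R₀ / 2 + R ≤ W →
        (∀ i, ((P.L ^ k * M0 i : ℕ) : ℝ) + R ≤ P.sitesPerDir 0) →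
      ∀ (ζ : Balaban1983to89.Site P 0 → Balaban1983to89.Site P 0 → ℝ), (∀ x y, |ζ x y| ≤ 1) →
        (∀ x y, R₀ ≤ B5Ineq137Torus.T P 0 x y → ζ x y = 0) → (∀ x y, B5Ineq137Torus.T P 0 x y ≤ R₁ → ζ x y = 1) →
        (∀ (x y : Balaban1983to89.Site P 0) (ν : Fin P.d), |ζ (x.shift ν) y - ζ x y| ≤ K₁ / (R₀ - R₁)) →
        (∀ (x y : Balaban1983to89.Site P 0) (κ ν : Fin P.d),
          |ζ ((x.shift ν).shift κ) y - ζ (x.shift ν) y - ζ (x.shift κ) y + ζ x y| ≤ K₂ / (R₀ - R₁) ^ 2) →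
      ∀ (x₁ x₂ : Balaban1983to89.Site P 0) (μ : Fin P.d),
        x₁ ∈ (cubeT hPd (P.L ^ k) c fun i => P.L ^ k * M0 i) →
        (∀ i, R₀ + R ≤ (boxCoord hPd (P.L ^ k) c x₁ i : ℝ) ∧ (boxCoord hPd (P.L ^ k) c x₁ i : ℝ) + (R₀ + R) ≤ (P.L ^ k * M0 i : ℕ) - 1) →
        x₁.shift μ ∈ (cubeT hPd (P.L ^ k) c fun i => P.L ^ k * M0 i) →
        (∀ i, R₀ + R ≤ (boxCoord hPd (P.L ^ k) c (x₁.shift μ) i : ℝ) ∧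
          (boxCoord hPd (P.L ^ k) c (x₁.shift μ) i : ℝ) + (R₀ + R) ≤ (P.L ^ k * M0 i : ℕ) - 1) →
        x₂ ∈ (cubeT hPd (P.L ^ k) c fun i => P.L ^ k * M0 i) →
        (∀ i, R₀ + R ≤ (boxCoord hPd (P.L ^ k) c x₂ i : ℝ) ∧ (boxCoord hPd (P.L ^ k) c x₂ i : ℝ) + (R₀ + R) ≤ (P.L ^ k * M0 i : ℕ) - 1) →
        x₂.shift μ ∈ (cubeT hPd (P.L ^ k) c fun i => P.L ^ k * M0 i) →
        (∀ i, R₀ + R ≤ (boxCoord hPd (P.L ^ k) c (x₂.shift μ) i : ℝ) ∧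
          (boxCoord hPd (P.L ^ k) c (x₂.shift μ) i : ℝ) + (R₀ + R) ≤ (P.L ^ k * M0 i : ℕ) - 1) →
      ∀ (f : Balaban1983to89.Site P 0 → ℂ) (F D : ℝ), (∀ y, ‖f y‖ ≤ F) → 0 ≤ D →
        (∀ y, f y ≠ 0 → D ≤ B5Ineq137Torus.T P 0 x₁ y) → (∀ y, f y ≠ 0 → D ≤ B5Ineq137Torus.T P 0 x₂ y) →
        ((P.L : ℝ) ^ k / B5Ineq137Torus.T P 0 x₁ x₂) ^ θ *
          ‖stairHol U x₁ x₂ *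
              (covD P.eps⁻¹ (cfg U)
                  (gLocT (B1RG242Torus.α P a k * (P.L : ℝ) ^ (k * P.d)) P.eps⁻¹ U k
                    (cubeFam hPd (P.L ^ k) c M0 s W) (lamFam hPd (P.L ^ k) c M0 s) ζ *ᵥ f) ⟨x₂, μ⟩ -
                covD P.eps⁻¹ (cfg U) (gBox (B1RG242Torus.α P a k * (P.L : ℝ) ^ (k * P.d)) P.eps⁻¹ U k Ω *ᵥ f) ⟨x₂, μ⟩) -
            (covD P.eps⁻¹ (cfg U)
                (gLocT (B1RG242Torus.α P a k * (P.L : ℝ) ^ (k * P.d)) P.eps⁻¹ U k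
                  (cubeFam hPd (P.L ^ k) c M0 s W) (lamFam hPd (P.L ^ k) c M0 s) ζ *ᵥ f) ⟨x₁, μ⟩ -
              covD P.eps⁻¹ (cfg U) (gBox (B1RG242Torus.α P a k * (P.L : ℝ) ^ (k * P.d)) P.eps⁻¹ U k Ω *ᵥ f) ⟨x₁, μ⟩)‖ ≤
          P.spacing k * (C * (1 + (P.L : ℝ) ^ k * ((R₀ - R₁)⁻¹ + (s : ℝ)⁻¹)) ^ 2 *
            ((⌊(((P.L : ℝ) ^ k) - 1 + R₀) / s⌋₊ + 3) ^ (d + 1) * Real.exp (-(δ₀ * (((P.L : ℝ) ^ k)⁻¹ * (2 * R - 1)))) +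
              Real.exp (-(δ₀ / 2 * (((P.L : ℝ) ^ k)⁻¹ * (R₁ - 1))))) *
            Real.exp (-(δ₀ / 2 * (((P.L : ℝ) ^ k)⁻¹ * D))) * F)  := by
  obtain ⟨δ₀, c₀, hδ₀, hc₀, HI⟩ := inputs6_smoothNear_region d ℓ hd1 hd3 hℓ hodd ha hθ0 hθ1
  obtain ⟨C, hC0, H⟩ := derivHolder231_region_of_inputs_of_smooth d hc₀.le hθ0 hθ1 hK₁ hK₂
  refine ⟨δ₀, C * Real.exp (3 * δ₀), hδ₀, by positivity, ?_⟩
  intro P hPd hPL k hk1 hkK hbig U Ω θp hθp0 hplaq hsm hΩ c M0 hM0 hfit0 hN0 hsub0 s W hs R R₀ R₁ hR hR₁ hR10 hW hgap ζ hζabs hζ0 hζR₁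
    hζ1 hζ2 x₁ x₂ μ hx₁ hdeep₁ hx₁e hdeep₁e hx₂ hdeep₂ hx₂e hdeep₂e f F D hF hD hsupp₁ hsupp₂
  obtain ⟨h1, h2, h3, h4, h5, h6⟩ := HI P hPd hPL k hk1 hkK hbig U Ω θp hθp0 hplaq hsm hΩ
  have hρ0 : (0 : ℝ) ≤ 17 * (P.L : ℝ) ^ k := by positivity
  exact H P hPd a k hk1 hkK U Ω δ₀ (17 * (P.L : ℝ) ^ k) hδ₀ hρ0 h1 h2 h3 h4 h5 h6 c M0 hM0 hfit0 hN0 hsub0 s W hs R R₀ R₁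
    (by linarith) hR₁ hR10 hW hgap ζ hζabs hζ0 hζR₁ hζ1 hζ2 x₁ x₂ μ hx₁ hdeep₁ hx₁e hdeep₁e hx₂ hdeep₂ hx₂e hdeep₂e f F D hF hD hsupp₁ hsupp₂

/-! ## §3 The member for the smooth product cut-off `ζ″ = ζ^Π(R₁, R₀)` of (2.29) -/

section ZetaPiMember

open BIJ88LocDeriv230ZetaPiFlatTorus (zetaPi_zero_eq_zero_of_le zetaPi_zero_eq_one_of_le abs_zetaPi_zero_le_one abs_zetaPi_zero_shift_sub_le
  abs_zetaPi_zero_secondDiff_le)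
open BIJ88HkLocHolderTorus (zetaPi secondDiffConst)
open Literature.Analysis.Calculus (exists_abs_deriv_and_deriv_deriv_smoothTransition_le)

set_option maxHeartbeats 800000 in
/-- **§2 AT r18's SMOOTH PRODUCT CUT-OFF `ζ″ = ζ^Π(R₁, R₀)` OF (2.29)** (print p. 263: *"ζ_k(x₁, x₂) is a smooth function of x₁ − x₂"*),
hypothesis-free in the cut-off for `1 ≤ R₁ < R₀ ≤ (|T^{(0)}| − 3)/2` (`K₁ = C_σ`, `K₂ = C_σ² + C_σ` from the universal profile bound), under the
local plaquette hypothesis of (2.32) (p27's `derivHolder231_smallPlaquette_region_zetaPi` VERBATIM otherwise).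
[cite: BalabanImbrieJaffe1988, (2.29), (2.31)–(2.32) p.263] [cite: BalabanImbrieJaffe1985, (7.3.1) p.326]
[cite: Balaban1983RegularityDecay, Theorem p.573 (1.9), (1.11)–(1.12)] -/
theorem derivHolder231_smoothNear_region_zetaPi (d ℓ : ℕ) (hd1 : 1 ≤ d) (hd3 : d + 1 ≤ 3) (hℓ : 1 ≤ ℓ) (hodd : Odd (ℓ + 1))
    {a : ℝ} (ha : 0 < a) {θ : ℝ} (hθ0 : 0 ≤ θ) (hθ1 : θ < 1) :
    ∃ δ₀ C : ℝ, 0 < δ₀ ∧ 0 < C ∧ ∀ (P : Params) (hPd : P.d = d + 1), P.L = ℓ + 1 →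
      ∀ (k : ℕ), 1 ≤ k → k ≤ P.K → 2 * (P.L ^ k - 1) + 4 < P.sitesPerDir 0 →
      ∀ (U : GaugeField P 0 U1) (Ω : Finset (Balaban1983to89.Site P 0)) (θp : ℝ), 0 ≤ θp →
        (∀ p : Balaban1983to89.Plaq P 0, (∃ y ∈ Ω, supDist y p.src ≤ 2 * P.L ^ k) → ‖toC (plaqHol U p) - 1‖ ≤ θp) →
        (((P.L : ℝ) ^ k) ^ 2 * θp) ^ 2 ≤ 1 / 500 → IsBlockUnion k Ω →
      ∀ (c M0 : Fin (d + 1) → ℕ), (∀ i, 1 ≤ M0 i) →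
        (∀ i, c i * P.L ^ k + P.L ^ k * M0 i ≤ P.sitesPerDir 0) → (∀ i, P.L ^ k * M0 i < P.sitesPerDir 0) →
        (cubeT hPd (P.L ^ k) c fun i => P.L ^ k * M0 i) ⊆ Ω →
      ∀ (s W : ℕ), 1 ≤ s → ∀ (R R₀ R₁ : ℝ), 18 * (P.L : ℝ) ^ k + 3 ≤ R → 1 ≤ R₁ → R₁ < R₀ → R₀ ≤ ((P.sitesPerDir 0 : ℝ) - 3) / 2 →
        2 * (s : ℝ) / 3 + R₀ / 2 + R ≤ W → (∀ i, ((P.L ^ k * M0 i : ℕ) : ℝ) + R ≤ P.sitesPerDir 0) →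
      ∀ (x₁ x₂ : Balaban1983to89.Site P 0) (μ : Fin P.d),
        x₁ ∈ (cubeT hPd (P.L ^ k) c fun i => P.L ^ k * M0 i) →
        (∀ i, R₀ + R ≤ (boxCoord hPd (P.L ^ k) c x₁ i : ℝ) ∧ (boxCoord hPd (P.L ^ k) c x₁ i : ℝ) + (R₀ + R) ≤ (P.L ^ k * M0 i : ℕ) - 1) →
        x₁.shift μ ∈ (cubeT hPd (P.L ^ k) c fun i => P.L ^ k * M0 i) →
        (∀ i, R₀ + R ≤ (boxCoord hPd (P.L ^ k) c (x₁.shift μ) i : ℝ) ∧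
          (boxCoord hPd (P.L ^ k) c (x₁.shift μ) i : ℝ) + (R₀ + R) ≤ (P.L ^ k * M0 i : ℕ) - 1) →
        x₂ ∈ (cubeT hPd (P.L ^ k) c fun i => P.L ^ k * M0 i) →
        (∀ i, R₀ + R ≤ (boxCoord hPd (P.L ^ k) c x₂ i : ℝ) ∧ (boxCoord hPd (P.L ^ k) c x₂ i : ℝ) + (R₀ + R) ≤ (P.L ^ k * M0 i : ℕ) - 1) →
        x₂.shift μ ∈ (cubeT hPd (P.L ^ k) c fun i => P.L ^ k * M0 i) →
        (∀ i, R₀ + R ≤ (boxCoord hPd (P.L ^ k) c (x₂.shift μ) i : ℝ) ∧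
          (boxCoord hPd (P.L ^ k) c (x₂.shift μ) i : ℝ) + (R₀ + R) ≤ (P.L ^ k * M0 i : ℕ) - 1) →
      ∀ (f : Balaban1983to89.Site P 0 → ℂ) (F D : ℝ), (∀ y, ‖f y‖ ≤ F) → 0 ≤ D →
        (∀ y, f y ≠ 0 → D ≤ B5Ineq137Torus.T P 0 x₁ y) → (∀ y, f y ≠ 0 → D ≤ B5Ineq137Torus.T P 0 x₂ y) →
        ((P.L : ℝ) ^ k / B5Ineq137Torus.T P 0 x₁ x₂) ^ θ *
          ‖stairHol U x₁ x₂ *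
              (covD P.eps⁻¹ (cfg U)
                  (gLocT (B1RG242Torus.α P a k * (P.L : ℝ) ^ (k * P.d)) P.eps⁻¹ U k
                    (cubeFam hPd (P.L ^ k) c M0 s W) (lamFam hPd (P.L ^ k) c M0 s) (zetaPi R₁ R₀ 0) *ᵥ f) ⟨x₂, μ⟩ -
                covD P.eps⁻¹ (cfg U) (gBox (B1RG242Torus.α P a k * (P.L : ℝ) ^ (k * P.d)) P.eps⁻¹ U k Ω *ᵥ f) ⟨x₂, μ⟩) -
            (covD P.eps⁻¹ (cfg U)
                (gLocT (B1RG242Torus.α P a k * (P.L : ℝ) ^ (k * P.d)) P.eps⁻¹ U k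
                  (cubeFam hPd (P.L ^ k) c M0 s W) (lamFam hPd (P.L ^ k) c M0 s) (zetaPi R₁ R₀ 0) *ᵥ f) ⟨x₁, μ⟩ -
              covD P.eps⁻¹ (cfg U) (gBox (B1RG242Torus.α P a k * (P.L : ℝ) ^ (k * P.d)) P.eps⁻¹ U k Ω *ᵥ f) ⟨x₁, μ⟩)‖ ≤
          P.spacing k * (C * (1 + (P.L : ℝ) ^ k * ((R₀ - R₁)⁻¹ + (s : ℝ)⁻¹)) ^ 2 *
            ((⌊(((P.L : ℝ) ^ k) - 1 + R₀) / s⌋₊ + 3) ^ (d + 1) * Real.exp (-(δ₀ * (((P.L : ℝ) ^ k)⁻¹ * (2 * R - 1)))) +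
              Real.exp (-(δ₀ / 2 * (((P.L : ℝ) ^ k)⁻¹ * (R₁ - 1))))) *
            Real.exp (-(δ₀ / 2 * (((P.L : ℝ) ^ k)⁻¹ * D))) * F)  := by
  obtain ⟨Cσ, hCσ0, hCσ1, hCσ2⟩ := exists_abs_deriv_and_deriv_deriv_smoothTransition_le
  have hK₂ : 0 ≤ Cσ ^ 2 + Cσ := by positivity
  obtain ⟨δ₀, C, hδ₀, hC0, H⟩ := derivHolder231_smoothNear_region_of_smooth d ℓ hd1 hd3 hℓ hodd ha hθ0 hθ1 hCσ0 hK₂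
  refine ⟨δ₀, C, hδ₀, hC0, ?_⟩
  intro P hPd hPL k hk1 hkK hbig U Ω θp hθp0 hplaq hsm hΩ c M0 hM0 hfit0 hN0 hsub0 s W hs R R₀ R₁ hR hR₁ hR10 hR₀N hW hgap
    x₁ x₂ μ hx₁ hdeep₁ hx₁e hdeep₁e hx₂ hdeep₂ hx₂e hdeep₂e f F D hF hD hsupp₁ hsupp₂
  have e : secondDiffConst Cσ R₁ R₀ = (Cσ ^ 2 + Cσ) / (R₀ - R₁) ^ 2 := by rw [secondDiffConst, div_pow, add_div]
  exact H P hPd hPL k hk1 hkK hbig U Ω θp hθp0 hplaq hsm hΩ c M0 hM0 hfit0 hN0 hsub0 s W hs R R₀ R₁ hR (zero_le_one.trans hR₁) hR10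
    hW hgap
    (zetaPi R₁ R₀ 0) (abs_zetaPi_zero_le_one R₁ R₀) (zetaPi_zero_eq_zero_of_le hR10) (zetaPi_zero_eq_one_of_le hR10)
    (abs_zetaPi_zero_shift_sub_le hCσ1 hR10) (fun x y κ ν => (abs_zetaPi_zero_secondDiff_le hCσ1 hCσ2 hR10 hR₁ hR₀N x y κ ν).trans_eq e)
    x₁ x₂ μ hx₁ hdeep₁ hx₁e hdeep₁e hx₂ hdeep₂ hx₂e hdeep₂e f F D hF hD hsupp₁ hsupp₂

end ZetaPiMember


/-! ## §4 The same UNDER THE PRINTED (2.32): r18's `SmoothOn` near `Ω` -/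

section Smooth

open BIJ88HkLocHolderTorus (zetaPi)

/-- **THE ORDER-`(1+θ)` MEMBER OF (2.31) FOR A `k`-BLOCK REGION `Ω ⊇ Ω₀` UNDER THE PRINTED (2.32)** ([BalabanImbrieJaffe1988] p. 263: *"for
(2.31) we assume smoothness throughout the subset Ω ⊂ T_η. This means that in a neighborhood of each □_α there exists an A, λ such that u =
exp[ie_kη(A + ∂λ)] with |∂A|, |∂*A| ≦ O(p(e_k)). (2.32)"*): §2 `derivHolder231_smoothNear_region_of_smooth` with the plaquette hypothesis
discharged from r18's `BIJ88Sect2Statements.SmoothOn e_k η C 𝓅 X Bd Pl (cfg u)` whenever `Pl` contains the plaquettes based within `2L^k` of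
`Ω` and `Bd` their bonds (p34 B-I's `plaqSmall_near_of_smoothOn`), threshold `(L^{2k}·e_kη²C𝓅)² ≤ 1/500` (`0 ≤ e_k`, `0 ≤ C𝓅`).
[cite: BalabanImbrieJaffe1988, (2.31)–(2.32) p.263] [cite: BalabanImbrieJaffe1985, (7.3.1) p.326]
[cite: Balaban1983RegularityDecay, Theorem p.573 (1.9), (1.11)–(1.12)] -/
theorem derivHolder231_smoothOn_region_of_smooth (d ℓ : ℕ) (hd1 : 1 ≤ d) (hd3 : d + 1 ≤ 3) (hℓ : 1 ≤ ℓ) (hodd : Odd (ℓ + 1))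
    {a : ℝ} (ha : 0 < a) {θ : ℝ} (hθ0 : 0 ≤ θ) (hθ1 : θ < 1) {K₁ K₂ : ℝ} (hK₁ : 0 ≤ K₁) (hK₂ : 0 ≤ K₂) :
    ∃ δ₀ C : ℝ, 0 < δ₀ ∧ 0 < C ∧ ∀ (P : Params) (hPd : P.d = d + 1), P.L = ℓ + 1 →
      ∀ (k : ℕ), 1 ≤ k → k ≤ P.K → 2 * (P.L ^ k - 1) + 4 < P.sitesPerDir 0 →
      ∀ (U : GaugeField P 0 U1) (Ω : Finset (Balaban1983to89.Site P 0)) (ek η Cp pek : ℝ), 0 ≤ ek → 0 ≤ Cp * pek →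
      ∀ (X : Finset (Balaban1983to89.Site P 0)) (Bd : Finset (PBond P 0)) (Pl : Finset (Balaban1983to89.Plaq P 0)),
        SmoothOn ek η Cp pek X Bd Pl (cfg U) →
        (∀ p : Balaban1983to89.Plaq P 0, (∃ y ∈ Ω, supDist y p.src ≤ 2 * P.L ^ k) → p ∈ Pl) →
        (∀ p ∈ Pl, (⟨p.src, p.μ⟩ : PBond P 0) ∈ Bd ∧ (⟨p.src.shift p.μ, p.ν⟩ : PBond P 0) ∈ Bd ∧
          (⟨p.src.shift p.ν, p.μ⟩ : PBond P 0) ∈ Bd ∧ (⟨p.src, p.ν⟩ : PBond P 0) ∈ Bd) →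
        (((P.L : ℝ) ^ k) ^ 2 * (ek * η ^ 2 * (Cp * pek))) ^ 2 ≤ 1 / 500 → IsBlockUnion k Ω →
      ∀ (c M0 : Fin (d + 1) → ℕ), (∀ i, 1 ≤ M0 i) →
        (∀ i, c i * P.L ^ k + P.L ^ k * M0 i ≤ P.sitesPerDir 0) → (∀ i, P.L ^ k * M0 i < P.sitesPerDir 0) →
        (cubeT hPd (P.L ^ k) c fun i => P.L ^ k * M0 i) ⊆ Ω →
      ∀ (s W : ℕ), 1 ≤ s → ∀ (R R₀ R₁ : ℝ), 18 * (P.L : ℝ) ^ k + 3 ≤ R → 0 ≤ R₁ → R₁ < R₀ → 2 * (s : ℝ) / 3 + R₀ / 2 + R ≤ W →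
        (∀ i, ((P.L ^ k * M0 i : ℕ) : ℝ) + R ≤ P.sitesPerDir 0) →
      ∀ (ζ : Balaban1983to89.Site P 0 → Balaban1983to89.Site P 0 → ℝ), (∀ x y, |ζ x y| ≤ 1) →
        (∀ x y, R₀ ≤ B5Ineq137Torus.T P 0 x y → ζ x y = 0) → (∀ x y, B5Ineq137Torus.T P 0 x y ≤ R₁ → ζ x y = 1) →
        (∀ (x y : Balaban1983to89.Site P 0) (ν : Fin P.d), |ζ (x.shift ν) y - ζ x y| ≤ K₁ / (R₀ - R₁)) →
        (∀ (x y : Balaban1983to89.Site P 0) (κ ν : Fin P.d),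
          |ζ ((x.shift ν).shift κ) y - ζ (x.shift ν) y - ζ (x.shift κ) y + ζ x y| ≤ K₂ / (R₀ - R₁) ^ 2) →
      ∀ (x₁ x₂ : Balaban1983to89.Site P 0) (μ : Fin P.d),
        x₁ ∈ (cubeT hPd (P.L ^ k) c fun i => P.L ^ k * M0 i) →
        (∀ i, R₀ + R ≤ (boxCoord hPd (P.L ^ k) c x₁ i : ℝ) ∧ (boxCoord hPd (P.L ^ k) c x₁ i : ℝ) + (R₀ + R) ≤ (P.L ^ k * M0 i : ℕ) - 1) →
        x₁.shift μ ∈ (cubeT hPd (P.L ^ k) c fun i => P.L ^ k * M0 i) →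
        (∀ i, R₀ + R ≤ (boxCoord hPd (P.L ^ k) c (x₁.shift μ) i : ℝ) ∧
          (boxCoord hPd (P.L ^ k) c (x₁.shift μ) i : ℝ) + (R₀ + R) ≤ (P.L ^ k * M0 i : ℕ) - 1) →
        x₂ ∈ (cubeT hPd (P.L ^ k) c fun i => P.L ^ k * M0 i) →
        (∀ i, R₀ + R ≤ (boxCoord hPd (P.L ^ k) c x₂ i : ℝ) ∧ (boxCoord hPd (P.L ^ k) c x₂ i : ℝ) + (R₀ + R) ≤ (P.L ^ k * M0 i : ℕ) - 1) →
        x₂.shift μ ∈ (cubeT hPd (P.L ^ k) c fun i => P.L ^ k * M0 i) →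
        (∀ i, R₀ + R ≤ (boxCoord hPd (P.L ^ k) c (x₂.shift μ) i : ℝ) ∧
          (boxCoord hPd (P.L ^ k) c (x₂.shift μ) i : ℝ) + (R₀ + R) ≤ (P.L ^ k * M0 i : ℕ) - 1) →
      ∀ (f : Balaban1983to89.Site P 0 → ℂ) (F D : ℝ), (∀ y, ‖f y‖ ≤ F) → 0 ≤ D →
        (∀ y, f y ≠ 0 → D ≤ B5Ineq137Torus.T P 0 x₁ y) → (∀ y, f y ≠ 0 → D ≤ B5Ineq137Torus.T P 0 x₂ y) →
        ((P.L : ℝ) ^ k / B5Ineq137Torus.T P 0 x₁ x₂) ^ θ *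
          ‖stairHol U x₁ x₂ *
              (covD P.eps⁻¹ (cfg U)
                  (gLocT (B1RG242Torus.α P a k * (P.L : ℝ) ^ (k * P.d)) P.eps⁻¹ U k
                    (cubeFam hPd (P.L ^ k) c M0 s W) (lamFam hPd (P.L ^ k) c M0 s) ζ *ᵥ f) ⟨x₂, μ⟩ -
                covD P.eps⁻¹ (cfg U) (gBox (B1RG242Torus.α P a k * (P.L : ℝ) ^ (k * P.d)) P.eps⁻¹ U k Ω *ᵥ f) ⟨x₂, μ⟩) -
            (covD P.eps⁻¹ (cfg U)
                (gLocT (B1RG242Torus.α P a k * (P.L : ℝ) ^ (k * P.d)) P.eps⁻¹ U k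
                  (cubeFam hPd (P.L ^ k) c M0 s W) (lamFam hPd (P.L ^ k) c M0 s) ζ *ᵥ f) ⟨x₁, μ⟩ -
              covD P.eps⁻¹ (cfg U) (gBox (B1RG242Torus.α P a k * (P.L : ℝ) ^ (k * P.d)) P.eps⁻¹ U k Ω *ᵥ f) ⟨x₁, μ⟩)‖ ≤
          P.spacing k * (C * (1 + (P.L : ℝ) ^ k * ((R₀ - R₁)⁻¹ + (s : ℝ)⁻¹)) ^ 2 *
            ((⌊(((P.L : ℝ) ^ k) - 1 + R₀) / s⌋₊ + 3) ^ (d + 1) * Real.exp (-(δ₀ * (((P.L : ℝ) ^ k)⁻¹ * (2 * R - 1)))) +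
              Real.exp (-(δ₀ / 2 * (((P.L : ℝ) ^ k)⁻¹ * (R₁ - 1))))) *
            Real.exp (-(δ₀ / 2 * (((P.L : ℝ) ^ k)⁻¹ * D))) * F)  := by
  obtain ⟨δ₀, C, hδ₀, hC0, H⟩ := derivHolder231_smoothNear_region_of_smooth d ℓ hd1 hd3 hℓ hodd ha hθ0 hθ1 hK₁ hK₂
  refine ⟨δ₀, C, hδ₀, hC0, ?_⟩
  intro P hPd hPL k hk1 hkK hbig U Ω ek η Cp pek hek hCp X Bd Pl hS hPl hBd hτ hΩ
  exact H P hPd hPL k hk1 hkK hbig U Ω (ek * η ^ 2 * (Cp * pek)) (by positivity) (plaqSmall_near_of_smoothOn hek hS hPl hBd) hτ hΩ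

/-- **§3 (r18's smooth product cut-off `ζ″ = ζ^Π(R₁, R₀)`) UNDER THE PRINTED (2.32)**: `derivHolder231_smoothNear_region_zetaPi` with the plaquette
hypothesis discharged from r18's `SmoothOn e_k η C 𝓅 X Bd Pl (cfg u)` (`Pl ⊇` the plaquettes based within `2L^k` of `Ω`, `Bd ⊇` their bonds),
threshold `(L^{2k}·e_kη²C𝓅)² ≤ 1/500`.
[cite: BalabanImbrieJaffe1988, (2.29), (2.31)–(2.32) p.263] [cite: BalabanImbrieJaffe1985, (7.3.1) p.326]
[cite: Balaban1983RegularityDecay, Theorem p.573 (1.9), (1.11)–(1.12)] -/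
theorem derivHolder231_smoothOn_region_zetaPi (d ℓ : ℕ) (hd1 : 1 ≤ d) (hd3 : d + 1 ≤ 3) (hℓ : 1 ≤ ℓ) (hodd : Odd (ℓ + 1))
    {a : ℝ} (ha : 0 < a) {θ : ℝ} (hθ0 : 0 ≤ θ) (hθ1 : θ < 1) :
    ∃ δ₀ C : ℝ, 0 < δ₀ ∧ 0 < C ∧ ∀ (P : Params) (hPd : P.d = d + 1), P.L = ℓ + 1 →
      ∀ (k : ℕ), 1 ≤ k → k ≤ P.K → 2 * (P.L ^ k - 1) + 4 < P.sitesPerDir 0 →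
      ∀ (U : GaugeField P 0 U1) (Ω : Finset (Balaban1983to89.Site P 0)) (ek η Cp pek : ℝ), 0 ≤ ek → 0 ≤ Cp * pek →
      ∀ (X : Finset (Balaban1983to89.Site P 0)) (Bd : Finset (PBond P 0)) (Pl : Finset (Balaban1983to89.Plaq P 0)),
        SmoothOn ek η Cp pek X Bd Pl (cfg U) →
        (∀ p : Balaban1983to89.Plaq P 0, (∃ y ∈ Ω, supDist y p.src ≤ 2 * P.L ^ k) → p ∈ Pl) →
        (∀ p ∈ Pl, (⟨p.src, p.μ⟩ : PBond P 0) ∈ Bd ∧ (⟨p.src.shift p.μ, p.ν⟩ : PBond P 0) ∈ Bd ∧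
          (⟨p.src.shift p.ν, p.μ⟩ : PBond P 0) ∈ Bd ∧ (⟨p.src, p.ν⟩ : PBond P 0) ∈ Bd) →
        (((P.L : ℝ) ^ k) ^ 2 * (ek * η ^ 2 * (Cp * pek))) ^ 2 ≤ 1 / 500 → IsBlockUnion k Ω →
      ∀ (c M0 : Fin (d + 1) → ℕ), (∀ i, 1 ≤ M0 i) →
        (∀ i, c i * P.L ^ k + P.L ^ k * M0 i ≤ P.sitesPerDir 0) → (∀ i, P.L ^ k * M0 i < P.sitesPerDir 0) →
        (cubeT hPd (P.L ^ k) c fun i => P.L ^ k * M0 i) ⊆ Ω →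
      ∀ (s W : ℕ), 1 ≤ s → ∀ (R R₀ R₁ : ℝ), 18 * (P.L : ℝ) ^ k + 3 ≤ R → 1 ≤ R₁ → R₁ < R₀ → R₀ ≤ ((P.sitesPerDir 0 : ℝ) - 3) / 2 →
        2 * (s : ℝ) / 3 + R₀ / 2 + R ≤ W → (∀ i, ((P.L ^ k * M0 i : ℕ) : ℝ) + R ≤ P.sitesPerDir 0) →
      ∀ (x₁ x₂ : Balaban1983to89.Site P 0) (μ : Fin P.d),
        x₁ ∈ (cubeT hPd (P.L ^ k) c fun i => P.L ^ k * M0 i) →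
        (∀ i, R₀ + R ≤ (boxCoord hPd (P.L ^ k) c x₁ i : ℝ) ∧ (boxCoord hPd (P.L ^ k) c x₁ i : ℝ) + (R₀ + R) ≤ (P.L ^ k * M0 i : ℕ) - 1) →
        x₁.shift μ ∈ (cubeT hPd (P.L ^ k) c fun i => P.L ^ k * M0 i) →
        (∀ i, R₀ + R ≤ (boxCoord hPd (P.L ^ k) c (x₁.shift μ) i : ℝ) ∧
          (boxCoord hPd (P.L ^ k) c (x₁.shift μ) i : ℝ) + (R₀ + R) ≤ (P.L ^ k * M0 i : ℕ) - 1) →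
        x₂ ∈ (cubeT hPd (P.L ^ k) c fun i => P.L ^ k * M0 i) →
        (∀ i, R₀ + R ≤ (boxCoord hPd (P.L ^ k) c x₂ i : ℝ) ∧ (boxCoord hPd (P.L ^ k) c x₂ i : ℝ) + (R₀ + R) ≤ (P.L ^ k * M0 i : ℕ) - 1) →
        x₂.shift μ ∈ (cubeT hPd (P.L ^ k) c fun i => P.L ^ k * M0 i) →
        (∀ i, R₀ + R ≤ (boxCoord hPd (P.L ^ k) c (x₂.shift μ) i : ℝ) ∧
          (boxCoord hPd (P.L ^ k) c (x₂.shift μ) i : ℝ) + (R₀ + R) ≤ (P.L ^ k * M0 i : ℕ) - 1) →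
      ∀ (f : Balaban1983to89.Site P 0 → ℂ) (F D : ℝ), (∀ y, ‖f y‖ ≤ F) → 0 ≤ D →
        (∀ y, f y ≠ 0 → D ≤ B5Ineq137Torus.T P 0 x₁ y) → (∀ y, f y ≠ 0 → D ≤ B5Ineq137Torus.T P 0 x₂ y) →
        ((P.L : ℝ) ^ k / B5Ineq137Torus.T P 0 x₁ x₂) ^ θ *
          ‖stairHol U x₁ x₂ *
              (covD P.eps⁻¹ (cfg U)
                  (gLocT (B1RG242Torus.α P a k * (P.L : ℝ) ^ (k * P.d)) P.eps⁻¹ U k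
                    (cubeFam hPd (P.L ^ k) c M0 s W) (lamFam hPd (P.L ^ k) c M0 s) (zetaPi R₁ R₀ 0) *ᵥ f) ⟨x₂, μ⟩ -
                covD P.eps⁻¹ (cfg U) (gBox (B1RG242Torus.α P a k * (P.L : ℝ) ^ (k * P.d)) P.eps⁻¹ U k Ω *ᵥ f) ⟨x₂, μ⟩) -
            (covD P.eps⁻¹ (cfg U)
                (gLocT (B1RG242Torus.α P a k * (P.L : ℝ) ^ (k * P.d)) P.eps⁻¹ U k
                  (cubeFam hPd (P.L ^ k) c M0 s W) (lamFam hPd (P.L ^ k) c M0 s) (zetaPi R₁ R₀ 0) *ᵥ f) ⟨x₁, μ⟩ -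
              covD P.eps⁻¹ (cfg U) (gBox (B1RG242Torus.α P a k * (P.L : ℝ) ^ (k * P.d)) P.eps⁻¹ U k Ω *ᵥ f) ⟨x₁, μ⟩)‖ ≤
          P.spacing k * (C * (1 + (P.L : ℝ) ^ k * ((R₀ - R₁)⁻¹ + (s : ℝ)⁻¹)) ^ 2 *
            ((⌊(((P.L : ℝ) ^ k) - 1 + R₀) / s⌋₊ + 3) ^ (d + 1) * Real.exp (-(δ₀ * (((P.L : ℝ) ^ k)⁻¹ * (2 * R - 1)))) +
              Real.exp (-(δ₀ / 2 * (((P.L : ℝ) ^ k)⁻¹ * (R₁ - 1))))) *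
            Real.exp (-(δ₀ / 2 * (((P.L : ℝ) ^ k)⁻¹ * D))) * F)  := by
  obtain ⟨δ₀, C, hδ₀, hC0, H⟩ := derivHolder231_smoothNear_region_zetaPi d ℓ hd1 hd3 hℓ hodd ha hθ0 hθ1
  refine ⟨δ₀, C, hδ₀, hC0, ?_⟩
  intro P hPd hPL k hk1 hkK hbig U Ω ek η Cp pek hek hCp X Bd Pl hS hPl hBd hτ hΩ
  exact H P hPd hPL k hk1 hkK hbig U Ω (ek * η ^ 2 * (Cp * pek)) (by positivity) (plaqSmall_near_of_smoothOn hek hS hPl hBd) hτ hΩ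

end Smooth

end

end Literature.MathematicalPhysics.QuantumFieldTheory.BalabanImbrieJaffe1984to88.BIJ88LocDerivHolder231SmoothNearRegion
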